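import Summits.Schanuel.Schanuel.Theorems.RootDecomp1KHyper68

/-!
# RootDecomp1KHyper — lens 6, generation 17 «BILOG STAIRCASE CELL» (BilogStair.lean edition 5 aca95ecc…, 4212 l; §N–§O) — continuation (RootDecomp1KHyper69): §O non-vanishing of the inner resultant: `specXY`, `exists_aeval_rat_ne_zero`, `sliceT`, `exists_root_slice_eq_zero`, `nonVanishII_holds : NonVanishII` (PROVED), `transferII_of_conjDataII : ConjDataII → TransferII`

(lens-6 g17 `BilogStair.lean` EDITION 5, sha256 aca95ecc…629b, 4212 l, own farm rc 0 · 0 warn · 0 sorry · axioms std; §A–§M = editions 2–4 (ported as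
`RootDecomp1KHyper53`–`66`), §N–§O appended in edition 5 (NODE/EDITION5 L1783, statement diff 0 removed / 0 changed / 36 added; critic ACK L1789: additive,
verified symbol by symbol, PORT may proceed FROM ed.5 as one edition); port by census-1 gen 16 in parts `RootDecomp1KHyper67`–`69` — 67 = §N `ConjDataII` (Prop def,
UNDECIDED), `toPolyT`, `resT`, `NonVanishII` (Prop def), product formula `aeval_resT`, `resT_zero`, `norm_resT_le`, `plen`, `resT_bounds`; 68 = §N `innerNormII_of_pieces :
ConjDataII → NonVanishII → InnerNormII` (PROVED; one exponent uniform in k) + `transferII_of_conjData`; 69 = §O `specXY`, `sliceT`, `exists_root_slice_eq_zero`,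
`nonVanishII_holds : NonVanishII` (PROVED), `transferII_of_conjDataII : ConjDataII → TransferII`. PORT edits: eight generic one-liners private (per-part copies);
sixteen one-line docstrings added; statements and proofs otherwise verbatim. INSTRUMENTS of record, NO credit (critic L1789: TransferII is REDUCED to ConjDataII alone;
`conjDataII_holds` ⇒ TransferII proved as typed ⇒ ONE THEOREM credit on arrival; cell credit needs TransferI + member package). `--supports stmt-Schanuel-33363`; rung 0.)
-/

open Complex Polynomial IntermediateField Filter
open scoped BigOperators

namespace Summit.Schanuel.Schanuel.Theorems.RootDecomp1KHyper

namespace HyperCell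

namespace LatCell

namespace Bilog

variable {n : ℕ}
open Summit.Schanuel.Schanuel.Theorems.RootDecomp1KRelLiouvilleCell (mvPolyMeasure_one_of_polyMeasure ycoeff
  mvaeval_cons_eq_sum mvlen_ycoeff_le natDegree_finSuccEquiv_le_totalDegree norm_mvaeval_le_mvlen_mul_pow)

/-- Roots of the complexified integer polynomial are its complex zeros. -/
private theorem mem_roots_map_iff {f : ℤ[X]} (hf : f ≠ 0) (z : ℂ) :
    z ∈ (f.map (Int.castRingHom ℂ)).roots ↔ Polynomial.aeval z f = 0 := by
  rw [Polynomial.mem_roots ((Polynomial.map_ne_zero_iff (Int.castRingHom ℂ).injective_int).mpr hf),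
    Polynomial.IsRoot.def, Polynomial.eval_map, Polynomial.aeval_def, algebraMap_int_eq]

/-! ## §O  Non-vanishing of the inner resultant (PROVED) -/

section NonVanish

/-- The specialisation `G(p, q, T) ∈ ℚ[T]` of `G ∈ ℤ[x₁, x₂, T]` at rational `x₁ = p`, `x₂ = q`. -/
noncomputable def specXY (G : MvPolynomial (Fin 3) ℤ) (p q : ℚ) : ℚ[X] :=
  MvPolynomial.aeval ![Polynomial.C p, Polynomial.C q, (Polynomial.X : ℚ[X])] G

/-- Evaluating the rational specialisation `specXY G p q` at `T = t` is evaluating `G` at `(p, q, t)`. -/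
theorem aeval_specXY {A : Type*} [CommRing A] [Algebra ℚ A] (G : MvPolynomial (Fin 3) ℤ) (p q : ℚ)
    (γ : A) : Polynomial.aeval γ (specXY G p q) =
      MvPolynomial.aeval ![algebraMap ℚ A p, algebraMap ℚ A q, γ] G := by
  unfold specXY
  have h := DFunLike.congr_fun (MvPolynomial.comp_aeval (R := ℤ)
    ((Polynomial.aeval γ : ℚ[X] →ₐ[ℚ] A).toRingHom.toIntAlgHom)
    (f := ![Polynomial.C p, Polynomial.C q, (Polynomial.X : ℚ[X])])) G
  have hfun : (fun i => (Polynomial.aeval γ : ℚ[X] →ₐ[ℚ] A).toRingHom.toIntAlgHom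
      (![Polynomial.C p, Polynomial.C q, (Polynomial.X : ℚ[X])] i)) =
      ![algebraMap ℚ A p, algebraMap ℚ A q, γ] := by
    funext i
    match i with
    | 0 => simp
    | 1 => simp
    | 2 => simp
  rw [hfun] at h
  exact h

/-- The `T`-degree of the specialisation is at most the `T`-degree of `G`. -/
theorem natDegree_specXY_le (G : MvPolynomial (Fin 3) ℤ) (p q : ℚ) :
    (specXY G p q).natDegree ≤ G.support.sup (fun s => s 2) := by
  classical
  unfold specXY
  conv_lhs => rw [MvPolynomial.as_sum G]
  rw [map_sum]
  refine Polynomial.natDegree_sum_le_of_forall_le _ _ fun s hs => ?_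
  rw [MvPolynomial.aeval_monomial, Finsupp.prod_pow, Fin.prod_univ_three]
  simp only [Matrix.cons_val_zero, Matrix.cons_val_one, Matrix.cons_val_two, Matrix.head_cons,
    Matrix.tail_cons, eq_intCast, ← Polynomial.C_pow]
  refine natDegree_mul_le.trans ?_
  rw [natDegree_intCast, zero_add]
  refine natDegree_mul_le.trans ?_
  rw [natDegree_X_pow, ← Polynomial.C_mul, natDegree_C, zero_add]
  exact Finset.le_sup (f := fun s : Fin 3 →₀ ℕ => s 2) hs

/-- A non-zero integer polynomial has a rational non-root. -/
private theorem exists_aeval_rat_ne_zero {σ : Type*} {H : MvPolynomial σ ℤ} (hH : H ≠ 0) :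
    ∃ z : σ → ℚ, MvPolynomial.aeval z H ≠ 0 := by
  by_contra h
  push Not at h
  apply hH
  apply MvPolynomial.map_injective (Int.castRingHom ℚ) Int.cast_injective
  rw [map_zero]
  apply MvPolynomial.funext
  intro z
  rw [MvPolynomial.eval_map, map_zero, ← h z, MvPolynomial.aeval_def]
  congr 1

/-- `G(x₁, x₂, z) ∈ ℂ[x₁, x₂]` for a fixed complex `z`. -/
noncomputable def sliceT (G : MvPolynomial (Fin 3) ℤ) (z : ℂ) : MvPolynomial (Fin 2) ℂ :=
  MvPolynomial.aeval ![MvPolynomial.X 0, MvPolynomial.X 1, MvPolynomial.C z] G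

/-- Evaluating the slice `sliceT G z` at `v` is evaluating `G` at `(v₀, v₁, z)`. -/
theorem eval_sliceT (G : MvPolynomial (Fin 3) ℤ) (z : ℂ) (v : Fin 2 → ℂ) :
    MvPolynomial.eval v (sliceT G z) = MvPolynomial.aeval ![v 0, v 1, z] G := by
  unfold sliceT
  induction G using MvPolynomial.induction_on with
  | C a => simp
  | add p q hp hq => rw [map_add, map_add, hp, hq, map_add]
  | mul_X p i hp =>
    rw [map_mul, map_mul, hp, map_mul, MvPolynomial.aeval_X, MvPolynomial.aeval_X]
    congr 1
    match i with
    | 0 => simp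
    | 1 => simp
    | 2 => simp

/-- If `Res_T(f, G) = 0` then `G(x₁, x₂, z) ≡ 0` identically in `x₁, x₂` for some complex root `z`
of `f` (the product of the slices `G(·, ·, z)` over the roots vanishes on `ℂ²`, hence is the zero
polynomial, hence one slice is zero). -/
theorem exists_root_slice_eq_zero {f : ℤ[X]} (hf : f ≠ 0) (G : MvPolynomial (Fin 3) ℤ)
    (hres : resT f G = 0) :
    ∃ z : ℂ, Polynomial.aeval z f = 0 ∧ ∀ x y : ℂ, MvPolynomial.aeval ![x, y, z] G = 0 := by
  classical
  have hf' : f.map (Int.castRingHom ℂ) ≠ 0 := fun h0 =>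
    hf (Polynomial.map_injective (Int.castRingHom ℂ) Int.cast_injective (by rw [h0, Polynomial.map_zero]))
  have hlc : (f.map (Int.castRingHom ℂ)).leadingCoeff ≠ 0 := fun h0 =>
    hf' (Polynomial.leadingCoeff_eq_zero.mp h0)
  have hprod : ((f.map (Int.castRingHom ℂ)).roots.map (sliceT G)).prod = 0 := by
    apply MvPolynomial.funext
    intro v
    rw [map_zero, map_multiset_prod, Multiset.map_map]
    have h := aeval_resT f G (v 0) (v 1)
    rw [hres, map_zero] at h
    have h' := (mul_eq_zero.mp h.symm).resolve_left (pow_ne_zero _ hlc)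
    refine Eq.trans ?_ h'
    congr 1
    exact Multiset.map_congr rfl fun z _ => eval_sliceT G z v
  obtain ⟨z, hz, h0⟩ : ∃ z ∈ (f.map (Int.castRingHom ℂ)).roots, sliceT G z = 0 := by
    obtain ⟨z, hz, h⟩ := Multiset.mem_map.mp (Multiset.prod_eq_zero_iff.mp hprod)
    exact ⟨z, hz, h⟩
  refine ⟨z, (mem_roots_map_iff hf z).mp hz, fun x y => ?_⟩
  have := eval_sliceT G z ![x, y]
  rw [h0, map_zero] at this
  simpa using this.symm

/-- **NON-VANISHING OF THE INNER RESULTANT (PROVED).**  If `Res_T(f_k, G) = 0` then some conjugate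
`γ'` of `γ_k` kills `G(x₁, x₂, γ') ≡ 0`; specialising `x₁, x₂` to rationals `p, q` with
`G(p, q, T) ≢ 0` gives a rational polynomial of `T`-degree `≤ deg_T G` vanishing at `γ'`, hence
(common minimal polynomial) at `γ_k` — excluded eventually by `DegGrowth`. -/
theorem nonVanishII_holds : NonVanishII := by
  classical
  intro ℓ a b hdeg G hG
  obtain ⟨w, hw⟩ := exists_aeval_rat_ne_zero hG
  have hf' : specXY G (w 0) (w 1) ≠ 0 := by
    intro h0
    apply hw
    have h := aeval_specXY (A := ℚ) G (w 0) (w 1) (w 2)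
    rw [h0, map_zero] at h
    have hw' : (![algebraMap ℚ ℚ (w 0), algebraMap ℚ ℚ (w 1), w 2] : Fin 3 → ℚ) = w := by
      funext i
      match i with
      | 0 => simp
      | 1 => simp
      | 2 => rfl
    rw [hw'] at h
    exact h.symm
  filter_upwards [hdeg (G.support.sup fun s => s 2)] with k hk f hf0 hfγ hconj hres
  obtain ⟨z, hz, hGz⟩ := exists_root_slice_eq_zero hf0 G hres
  have hcz : IsConjRoot ℚ (gam ℓ a b k) z := hconj z hz
  have h1 : Polynomial.aeval z (specXY G (w 0) (w 1)) = 0 := by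
    rw [aeval_specXY]; simpa using hGz (w 0) (w 1)
  have h2 : minpoly ℚ (gam ℓ a b k) ∣ specXY G (w 0) (w 1) := by
    rw [show minpoly ℚ (gam ℓ a b k) = minpoly ℚ z from hcz]; exact minpoly.dvd ℚ z h1
  exact hk _ hf' (natDegree_specXY_le G _ _)
    (Polynomial.aeval_eq_zero_of_dvd_aeval_eq_zero h2 (minpoly.aeval ℚ _))

end NonVanish

/-- **TRANSFER II ⟸ CONJUGATE DATA** (PROVED reduction): after §L–§O the ONLY remaining input of the
exp-algebraic case (II) is `ConjDataII` — explicit conjugate data (degree, coefficient and house bounds)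
for the algebraic numbers `γ_k = exp(i(a_kπ + b_kℓ))`. -/
theorem transferII_of_conjDataII (hCD : ConjDataII) : TransferII :=
  transferII_of_conjData hCD nonVanishII_holds

end Bilog
end LatCell
end HyperCell
end Summit.Schanuel.Schanuel.Theorems.RootDecomp1KHyper
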